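import Mathlib
import Summits.NavierStokesRegularity.NavierStokesRegularity.Theorems.FilamentSkeletonRssMatchedKernelVariation

/-!
# The MATCHED-CORE Biot–Savart field: variation derivative with a MOVING evaluation point
# `d/ds|₀ ∫ K_m(y + s•v(u) − X u) • (X′u + sY′u) × (y + s•v(u) − X u) du` for any bounded continuous `v`

Route `FilamentSkeletonRss`, toward child **28296 `Clause13NearStraight`** of `SkeletonJ1G` (stmt-27849).  The linearised
normal-velocity map of clause 13-J differentiates `s ↦ u_{X+sY}((X+sY) j τ)`: the filament AND the evaluation point move.
With `y = X j τ`, `V = Y j τ` this is the parametric integral above with `v(u) = V − Y u` (for a partner filament `k ≠ j`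
the same with its own `X, Y`).  `…MatchedKernelVariation` (lane g12) treated `v = −Y`; this file runs the identical dominated-
differentiation argument for an ARBITRARY continuous `v` with `‖v u‖ ≤ B` (`matchedBiotSavart_hasDerivAt_affineVariation`)
and records the moving-point instance (`matchedBiotSavart_hasDerivAt_movingPoint`, `v u = V − Y u`, bound `‖V‖ + B`).
Lane ns-filament-19175-p1 g12; `--supports stmt-NavierStokesRegularity-28296 --as helper`.
HONEST FRAMING: calculus for a HYPOTHETICAL filament skeleton on the NEGATIVE side of a MODEL route; nothing here bears on
Navier–Stokes regularity or blow-up.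
-/

noncomputable section

open MeasureTheory Filter Topology Metric
open Literature.Analysis.FluidPDE

namespace Summit.NavierStokesRegularity.NavierStokesRegularity.Theorems.MatchedKernel
set_option linter.dupNamespace false

/-- Continuity in `u` of the affine-variation integrand at parameter `s` (`X, Y` of class `C¹`, `v` continuous). [folklore] -/
theorem continuous_affineVariationIntegrand {m : ℝ → ℝ} {m₀ : ℝ} (hm₀ : 0 < m₀) (hm : ∀ u, m₀ ≤ m u) (hmc : Continuous m)
    {X Y v : ℝ → EuclideanSpace ℝ (Fin 3)} (hX : ContDiff ℝ 1 X) (hY : ContDiff ℝ 1 Y) (hv : Continuous v)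
    (y : EuclideanSpace ℝ (Fin 3)) (s : ℝ) :
    Continuous (fun u : ℝ => ((‖y + s • v u - X u‖ ^ 2 + m u) ^ (3 / 2 : ℝ))⁻¹ •
      cross (deriv X u + s • deriv Y u) (y + s • v u - X u)) := by
  have hXc : Continuous X := hX.continuous
  have hX'c : Continuous (deriv X) := hX.continuous_deriv le_rfl
  have hYc : Continuous Y := hY.continuous
  have hY'c : Continuous (deriv Y) := hY.continuous_deriv le_rfl
  have hw : Continuous (fun u : ℝ => y + s • v u - X u) := by fun_prop
  have hpos : ∀ u, (0 : ℝ) < ‖y + s • v u - X u‖ ^ 2 + m u := fun u =>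
    add_pos_of_nonneg_of_pos (sq_nonneg _) (hm₀.trans_le (hm u))
  have hk : Continuous (fun u : ℝ => ((‖y + s • v u - X u‖ ^ 2 + m u) ^ (3 / 2 : ℝ))⁻¹) :=
    (((hw.norm.pow 2).add hmc).rpow_const fun u => Or.inl (hpos u).ne').inv₀
      fun u => (Real.rpow_pos_of_pos (hpos u) _).ne'
  have hcr : Continuous (fun u => cross (deriv X u + s • deriv Y u) (y + s • v u - X u)) :=
    (crossCLM.continuous.comp (by fun_prop : Continuous fun u => deriv X u + s • deriv Y u)).clm_apply hw
  exact hk.smul hcr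

/-- Continuity in `u` of the `s`-derivative of the affine-variation integrand at parameter `s`. [folklore] -/
theorem continuous_affineVariationDeriv {m : ℝ → ℝ} {m₀ : ℝ} (hm₀ : 0 < m₀) (hm : ∀ u, m₀ ≤ m u) (hmc : Continuous m)
    {X Y v : ℝ → EuclideanSpace ℝ (Fin 3)} (hX : ContDiff ℝ 1 X) (hY : ContDiff ℝ 1 Y) (hv : Continuous v)
    (y : EuclideanSpace ℝ (Fin 3)) (s : ℝ) :
    Continuous (fun u : ℝ =>
      (-3 * inner ℝ (y + s • v u - X u) (v u) * ((‖y + s • v u - X u‖ ^ 2 + m u) ^ (5 / 2 : ℝ))⁻¹) •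
          cross (deriv X u + s • deriv Y u) (y + s • v u - X u) +
        ((‖y + s • v u - X u‖ ^ 2 + m u) ^ (3 / 2 : ℝ))⁻¹ •
          (cross (deriv X u + s • deriv Y u) (v u) + cross (deriv Y u) (y + s • v u - X u))) := by
  have hXc : Continuous X := hX.continuous
  have hX'c : Continuous (deriv X) := hX.continuous_deriv le_rfl
  have hYc : Continuous Y := hY.continuous
  have hY'c : Continuous (deriv Y) := hY.continuous_deriv le_rfl
  have hw : Continuous (fun u : ℝ => y + s • v u - X u) := by fun_prop
  have hp : Continuous (fun u : ℝ => deriv X u + s • deriv Y u) := by fun_prop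
  have hpos : ∀ u, (0 : ℝ) < ‖y + s • v u - X u‖ ^ 2 + m u := fun u =>
    add_pos_of_nonneg_of_pos (sq_nonneg _) (hm₀.trans_le (hm u))
  have hk : ∀ r : ℝ, Continuous (fun u : ℝ => ((‖y + s • v u - X u‖ ^ 2 + m u) ^ r)⁻¹) := fun r =>
    (((hw.norm.pow 2).add hmc).rpow_const fun u => Or.inl (hpos u).ne').inv₀
      fun u => (Real.rpow_pos_of_pos (hpos u) _).ne'
  have hcr1 : Continuous (fun u => cross (deriv X u + s • deriv Y u) (y + s • v u - X u)) :=
    (crossCLM.continuous.comp hp).clm_apply hw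
  have hcr2 : Continuous (fun u => cross (deriv X u + s • deriv Y u) (v u)) :=
    (crossCLM.continuous.comp hp).clm_apply hv
  have hcr3 : Continuous (fun u => cross (deriv Y u) (y + s • v u - X u)) :=
    (crossCLM.continuous.comp hY'c).clm_apply hw
  exact (((continuous_const.mul (hw.inner hv)).mul (hk _)).smul hcr1).add ((hk _).smul (hcr2.add hcr3))

/-- **THE AFFINE-VARIATION DERIVATIVE of the matched-core Biot–Savart field** (differentiation under the integral sign at
`s = 0`, line form `y + s•v(u) − X u` with ANY continuous `v`, `‖v u‖ ≤ B`): for a `C¹` proper filament `X` (`‖X′‖ ≤ 1`,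
`c|u| − C ≤ ‖X u‖`), a `C¹` tangent displacement rate `Y′` with `‖Y′ u‖ ≤ B`, and a continuous core profile `m ≥ m₀ > 0`,
the derivative integrand is integrable and `s ↦ ∫ K₃ • (X′ + sY′) × (y + s v − X)` has the stated derivative at `0`. [folklore] -/
theorem matchedBiotSavart_hasDerivAt_affineVariation {m : ℝ → ℝ} {m₀ c C B : ℝ} {X Y v : ℝ → EuclideanSpace ℝ (Fin 3)}
    (hm₀ : 0 < m₀) (hm : ∀ u, m₀ ≤ m u) (hmc : Continuous m) (hc : 0 < c) (hX : ContDiff ℝ 1 X)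
    (hX1 : ∀ u, ‖deriv X u‖ ≤ 1) (hXg : ∀ u, c * |u| - C ≤ ‖X u‖) (hY : ContDiff ℝ 1 Y) (hB : 0 ≤ B)
    (hY'b : ∀ u, ‖deriv Y u‖ ≤ B) (hv : Continuous v) (hvb : ∀ u, ‖v u‖ ≤ B) (y : EuclideanSpace ℝ (Fin 3)) :
    Integrable (fun u : ℝ =>
        (-3 * inner ℝ (y - X u) (v u) * ((‖y - X u‖ ^ 2 + m u) ^ (5 / 2 : ℝ))⁻¹) • cross (deriv X u) (y - X u) +
          ((‖y - X u‖ ^ 2 + m u) ^ (3 / 2 : ℝ))⁻¹ • (cross (deriv X u) (v u) + cross (deriv Y u) (y - X u))) ∧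
    HasDerivAt (fun s : ℝ => ∫ u : ℝ, ((‖y + s • v u - X u‖ ^ 2 + m u) ^ (3 / 2 : ℝ))⁻¹ •
        cross (deriv X u + s • deriv Y u) (y + s • v u - X u))
      (∫ u : ℝ, ((-3 * inner ℝ (y - X u) (v u) * ((‖y - X u‖ ^ 2 + m u) ^ (5 / 2 : ℝ))⁻¹) •
          cross (deriv X u) (y - X u) +
        ((‖y - X u‖ ^ 2 + m u) ^ (3 / 2 : ℝ))⁻¹ • (cross (deriv X u) (v u) + cross (deriv Y u) (y - X u)))) 0 := by
  set M : ℝ := (4 * m₀ + c ^ 2 + 4 * (|C| + ‖y‖ + B + 1) ^ 2) / (c ^ 2 * m₀) with hM_def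
  set Cst : ℝ := B + 4 * B * (1 + B) * (Real.sqrt m₀)⁻¹ with hCst_def
  have hq : ∀ u, 0 < m u := fun u => hm₀.trans_le (hm u)
  -- the parametric family and its derivative
  set F : ℝ → ℝ → EuclideanSpace ℝ (Fin 3) := fun s u =>
    ((‖y + s • v u - X u‖ ^ 2 + m u) ^ (3 / 2 : ℝ))⁻¹ • cross (deriv X u + s • deriv Y u) (y + s • v u - X u)
    with hF_def
  set F' : ℝ → ℝ → EuclideanSpace ℝ (Fin 3) := fun s u =>
    (-3 * inner ℝ (y + s • v u - X u) (v u) * ((‖y + s • v u - X u‖ ^ 2 + m u) ^ (5 / 2 : ℝ))⁻¹) •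
        cross (deriv X u + s • deriv Y u) (y + s • v u - X u) +
      ((‖y + s • v u - X u‖ ^ 2 + m u) ^ (3 / 2 : ℝ))⁻¹ •
        (cross (deriv X u + s • deriv Y u) (v u) + cross (deriv Y u) (y + s • v u - X u)) with hF'_def
  have hF0 : F' 0 = fun u =>
      (-3 * inner ℝ (y - X u) (v u) * ((‖y - X u‖ ^ 2 + m u) ^ (5 / 2 : ℝ))⁻¹) • cross (deriv X u) (y - X u) +
        ((‖y - X u‖ ^ 2 + m u) ^ (3 / 2 : ℝ))⁻¹ • (cross (deriv X u) (v u) + cross (deriv Y u) (y - X u)) := by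
    funext u; simp [F']
  -- the key: Mathlib's dominated differentiation
  have key := hasDerivAt_integral_of_dominated_loc_of_deriv_le (μ := volume) (x₀ := (0:ℝ)) (F := F) (F' := F')
    (s := Metric.ball (0:ℝ) 1) (bound := fun u => Cst * (M * (1 + u ^ 2)⁻¹))
    (Metric.ball_mem_nhds (0:ℝ) one_pos) ?_ ?_ ?_ ?_ ?_ ?_
  · rw [hF0] at key
    refine ⟨key.1, ?_⟩
    have hfun : (fun s : ℝ => ∫ u : ℝ, F s u) = fun s : ℝ => ∫ u : ℝ, ((‖y + s • v u - X u‖ ^ 2 + m u) ^ (3 / 2 : ℝ))⁻¹ •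
        cross (deriv X u + s • deriv Y u) (y + s • v u - X u) := rfl
    rw [hfun] at key
    exact key.2
  · -- measurability of `F s`
    exact Eventually.of_forall fun s => (continuous_affineVariationIntegrand hm₀ hm hmc hX hY hv y s).aestronglyMeasurable
  · -- integrability of `F 0` = the undisplaced integrand
    have h0 : F 0 = fun u => ((‖y - X u‖ ^ 2 + m u) ^ (3 / 2 : ℝ))⁻¹ • cross (deriv X u) (y - X u) := by
      funext u; simp [F]
    rw [h0]
    exact matchedBiotSavart_integrable hm₀ hm hmc hc hX hX1 hXg y
  · exact (continuous_affineVariationDeriv hm₀ hm hmc hX hY hv y 0).aestronglyMeasurable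
  · -- the uniform bound on the ball `|s| < 1`
    refine Eventually.of_forall fun u s hs => ?_
    have hs' : |s| ≤ 1 := le_of_lt (by simpa [Real.dist_eq] using hs)
    have hnb : ‖v u‖ ≤ B := hvb u
    have h1 := norm_variationDeriv_le (hq u) hB hs' (deriv X u) (deriv Y u) (y + s • v u - X u) (v u)
      (hX1 u) (hY'b u) hnb
    refine h1.trans ?_
    -- `(√(m u))⁻¹ ≤ (√m₀)⁻¹` and the domination `(‖w‖² + m u)⁻¹ ≤ M (1+u²)⁻¹`
    have hsq : (Real.sqrt (m u))⁻¹ ≤ (Real.sqrt m₀)⁻¹ :=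
      inv_anti₀ (Real.sqrt_pos.2 hm₀) (Real.sqrt_le_sqrt (hm u))
    have hz : ‖(y + s • v u) - y‖ ≤ B := by
      rw [add_sub_cancel_left, norm_smul, Real.norm_eq_abs]
      calc |s| * ‖v u‖ ≤ 1 * B := mul_le_mul hs' hnb (norm_nonneg _) zero_le_one
        _ = B := one_mul _
    have hdom := inv_le_of_norm_sub_le hm₀ hm hc hXg hB y hz u
    have hCst1 : B + 4 * B * (1 + B) * (Real.sqrt (m u))⁻¹ ≤ Cst := by
      rw [hCst_def]; gcongr
    have hpos : 0 ≤ (‖y + s • v u - X u‖ ^ 2 + m u)⁻¹ :=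
      inv_nonneg.2 (add_pos_of_nonneg_of_pos (sq_nonneg _) (hq u)).le
    have hCst0 : 0 ≤ Cst := by rw [hCst_def]; positivity
    calc (B + 4 * B * (1 + B) * (Real.sqrt (m u))⁻¹) * (‖y + s • v u - X u‖ ^ 2 + m u)⁻¹
        ≤ Cst * (‖y + s • v u - X u‖ ^ 2 + m u)⁻¹ := mul_le_mul_of_nonneg_right hCst1 hpos
      _ ≤ Cst * (M * (1 + u ^ 2)⁻¹) := mul_le_mul_of_nonneg_left hdom hCst0
  · exact (integrable_inv_one_add_sq.const_mul M).const_mul Cst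
  · exact Eventually.of_forall fun u s _ =>
      variationIntegrand_hasDerivAt (hq u) (deriv X u) (deriv Y u) y (v u) (X u) s


/-- **MOVING EVALUATION POINT**: the instance `v u = V − Y u` (`‖V‖ ≤ B`) — the derivative at `s = 0` of
`s ↦ ∫ K₃(y + sV − (X u + sY u)) • (X′u + sY′u) × (y + sV − (X u + sY u)) du`, i.e. the displaced filament's field followed
along the displaced point `y + sV` (for clause 13-J: `y = X j τ`, `V = Y j τ`). [folklore] -/
theorem matchedBiotSavart_hasDerivAt_movingPoint {m : ℝ → ℝ} {m₀ c C B : ℝ} {X Y : ℝ → EuclideanSpace ℝ (Fin 3)}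
    (hm₀ : 0 < m₀) (hm : ∀ u, m₀ ≤ m u) (hmc : Continuous m) (hc : 0 < c) (hX : ContDiff ℝ 1 X)
    (hX1 : ∀ u, ‖deriv X u‖ ≤ 1) (hXg : ∀ u, c * |u| - C ≤ ‖X u‖) (hY : ContDiff ℝ 1 Y) (hB : 0 ≤ B)
    (hYb : ∀ u, ‖Y u‖ ≤ B) (hY'b : ∀ u, ‖deriv Y u‖ ≤ B) (y V : EuclideanSpace ℝ (Fin 3)) (hV : ‖V‖ ≤ B) :
    HasDerivAt (fun s : ℝ => ∫ u : ℝ, ((‖y + s • (V - Y u) - X u‖ ^ 2 + m u) ^ (3 / 2 : ℝ))⁻¹ •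
        cross (deriv X u + s • deriv Y u) (y + s • (V - Y u) - X u))
      (∫ u : ℝ, ((-3 * inner ℝ (y - X u) (V - Y u) * ((‖y - X u‖ ^ 2 + m u) ^ (5 / 2 : ℝ))⁻¹) •
          cross (deriv X u) (y - X u) +
        ((‖y - X u‖ ^ 2 + m u) ^ (3 / 2 : ℝ))⁻¹ • (cross (deriv X u) (V - Y u) + cross (deriv Y u) (y - X u)))) 0 := by
  have hB2 : 0 ≤ 2 * B := by positivity
  have hv : Continuous (fun u => V - Y u) := continuous_const.sub hY.continuous
  have hvb : ∀ u, ‖V - Y u‖ ≤ 2 * B := fun u =>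
    (norm_sub_le _ _).trans (by linarith [hYb u, hV])
  have hY'b2 : ∀ u, ‖deriv Y u‖ ≤ 2 * B := fun u => (hY'b u).trans (by linarith [hY'b u, norm_nonneg (deriv Y u)])
  exact (matchedBiotSavart_hasDerivAt_affineVariation hm₀ hm hmc hc hX hX1 hXg hY hB2 hY'b2 hv hvb y).2

end Summit.NavierStokesRegularity.NavierStokesRegularity.Theorems.MatchedKernel
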